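import Summits.CriticalPhenomena.PercolationContinuityZ3.Theorems.PercNearOneGluingNoHeavyLowerTailMixCSHA2H
import Summits.CriticalPhenomena.PercolationContinuityZ3.Theorems.PercNearOneGluingNoHeavyLowerTailMixCSHHpart
import Summits.CriticalPhenomena.PercolationContinuityZ3.Theorems.PercNearOneGluingAdditiveGluingCSHHtwBridge
import Literature.Probability.Percolation.TwoSetConditionalAssociation
import HarnessLib

/-!
# Mixed conditioned slack hierarchy — two-set input for the hub weight, (Htw-mix) in world form, LEMMA H-mix UNCONDITIONALLY

Support file (`--supports stmt-CriticalPhenomena-4575`), prover `prim-ineq-gen-7` (gen 9).  No definitions, no named facts, no sorries.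
Memo `prim-ineq-gen-7/PROOF-Q9-MIXED-CSH.md` §3.4, blueprint §10 brick B4 (this file CLOSES brick B4); write-up `Q9-WRITEUP.md` Lemma 5.2 / Cor. 5.3.
* `CovTau.sum_weight_inter_eq_sum` — percolation on `G[U]` (connectivity through `ω ∩ edgesIn U`) is percolation with the weights off
  `edgesIn U` zeroed (pushforward; `BHK2006.integral_comp_sdiff_prodBernoulli'`).
* `CovTau.hubGP` — the finitary TWO-SET input `hGP` of `CovTau.metaA2_mix_of_star` / `a2Mix` / `p1Mix_univ` (gen 8), DISCHARGED: in every
  world `G[U]`, given `{v ↮ S}`, the bi-monotone hub weight `1{Σ∩C_v≠∅}·1{Σ⊆U, Σ↮S}` (↑ in `C_v`, ↓ in `C_S`) and the decreasing `1{v↮N}`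
  are negatively correlated — van den Berg–Häggström–Kahn's Thm 2.1 at `q = 1` with the sets `{v}`, `S` (tree `BHK2006_twoSetConditionalAssociation`).
* `CovTau.EavMix_univ_eq`, `EavMix_rest_univ`, `Mav_rest_univ` — dictionary between `E^mix` of the finite-sum framework and the `prodBernoulli`
  vocabulary of `MixCSH` (worlds = weights zeroed on the pairs meeting `C_Y(ω)`; the world condition `Σ ⊆ V ∖ C_Y(ω)` is the factor `1{Σ ↮_ω Y}`).
* `MixCSH.htwMix_world` — (Htw-mix) in world form, UNCONDITIONAL: exactly the hypothesis `hHtw` of `MixCSH.hpart_nonneg_of_htw_hub` (p211136).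
* `MixCSH.hpart_nonneg_hub` — LEMMA H with a hub observer, UNCONDITIONAL (brick B4 closed): for weights `< 1`, `x ∈ S`, `v ∉ S ∪ Y`, `g` monotone `≥ 0`,
  `0 ≤ ∫_{x↮Y} [1{Σ↮_ωY}·Cov_{w^ω}(g(C_x), 1{Σ ↔ S}) − p·Cov_{w^ω}(g(C_x), 1{v ↔ S})] dμ_w`, `p = μ(Σ∩C_v≠∅, Σ↮S∪Y | v↮S∪Y)`.
[cite: VandenbergHaggstromKahn2005, Thm. 2.1 (p. 9) at q = 1, Thm. 1.1 (pp. 3–5), Thm. 1.4 (p. 7), §2.1 Lemmas 2.3–2.4 (p. 10)]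
[cite: KozmaNitzan2024, Question 9 (§5.5 p. 36)]
-/

noncomputable section

namespace Summit.CriticalPhenomena.PercolationContinuityZ3.Theorems

open MeasureTheory Set
open Literature.Probability.LatticeModels (prodBernoulli)
open Literature.Probability.Percolation
open Literature.Probability.Percolation.BHK2006 (weight edgesIn rC rD weight_nonneg integral_comp_sdiff_prodBernoulli
  integral_prodBernoulli_eq_sum)
open Literature.Probability.Percolation.DecisionTree (ind ind_of_mem ind_of_not_mem ind_nonneg)
open scoped Classical

namespace CovTau

variable {V : Type*} [Fintype V]

/-! ### Percolation on `G[U]` is percolation with zeroed weights -/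

/-- **Restricting configurations to a fixed pair set `E` is zeroing the weights off `E`** (pushforward of the product weight):
`Σ_ω weight_w(ω) h(ω ∩ E) = Σ_η weight_{w'}(η) h(η)` with `w' = w` on `E` and `0` off `E`.
[cite: VandenbergHaggstromKahn2005, §2.1 Lemma 2.3 (p. 10)] -/
theorem sum_weight_inter_eq_sum (w : Sym2 V → ℝ) (hw0 : ∀ e, 0 ≤ w e) (hw1 : ∀ e, w e ≤ 1) (E : Set (Sym2 V))
    (p' : Sym2 V → unitInterval) (hE : ∀ e ∈ E, (p' e : ℝ) = w e) (hE' : ∀ e ∉ E, p' e = 0)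
    (h : Set (Sym2 V) → ℝ) :
    ∑ ω, weight w ω * h (ω ∩ E) = ∑ η, weight (fun e => (p' e : ℝ)) η * h η := by
  let p : Sym2 V → unitInterval := fun e => ⟨w e, ⟨hw0 e, hw1 e⟩⟩
  have h1 : ∑ ω, weight w ω * h (ω ∩ E) = ∑ ω, weight (fun e => (p e : ℝ)) ω * h (ω \ Eᶜ) := by
    refine Finset.sum_congr rfl fun ω _ => ?_
    rw [Set.sdiff_compl]
  rw [h1, sum_weight_mul_eq_integral, BHK2006.integral_comp_sdiff_prodBernoulli' p p' Eᶜ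
    (fun e he => hE' e he) (fun e he => Subtype.ext (hE e (not_notMem.1 he))) h, integral_prodBernoulli_eq_sum]

/-! ### Reading the hub weight and the avoidance indicators on the clusters -/

omit [Fintype V] in
/-- `1{Σ ⊆ U, Σ ↮ S}` is an antitone function of `C_S = ⋃_{s ∈ S} C_s`: no `σ ∈ Σ` lies in `S` or on an edge of `C_S`. [folklore] -/
theorem ind_avoid_hub_eq (Sig U : Finset V) (S : Set V) (η : Set (Sym2 V)) :
    ind {C : Set (Sym2 V) | ∀ σ ∈ Sig, σ ∈ U ∧ (σ ∉ S ∧ ∀ e ∈ C, σ ∉ e)} (⋃ t ∈ S, openEdgeCluster η t) =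
      ind {ζ : Set (Sym2 V) | ∀ σ ∈ Sig, σ ∈ U ∧ ∀ s ∈ S, ¬ (openGraph ζ).Reachable σ s} η := by
  have hiff : (⋃ t ∈ S, openEdgeCluster η t) ∈ {C : Set (Sym2 V) | ∀ σ ∈ Sig, σ ∈ U ∧ (σ ∉ S ∧ ∀ e ∈ C, σ ∉ e)} ↔
      η ∈ {ζ : Set (Sym2 V) | ∀ σ ∈ Sig, σ ∈ U ∧ ∀ s ∈ S, ¬ (openGraph ζ).Reachable σ s} := by
    simp only [mem_setOf_eq, mem_iUnion, exists_prop]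
    refine forall₂_congr fun σ _ => and_congr_right fun _ => ?_
    constructor
    · rintro ⟨hσS, hσe⟩ s hs hr
      rcases (reachable_iff_exists_mem_openEdgeCluster η s σ).1 hr.symm with h | ⟨e, he, hσ⟩
      · exact hσS (h ▸ hs)
      · exact hσe e ⟨s, hs, he⟩ hσ
    · intro h
      refine ⟨fun hσS => h σ hσS (SimpleGraph.Reachable.refl σ), fun e ⟨s, hs, he⟩ hσ => ?_⟩
      exact h s hs ((reachable_iff_exists_mem_openEdgeCluster η s σ).2 (Or.inr ⟨e, he, hσ⟩)).symm
  by_cases hη : η ∈ {ζ : Set (Sym2 V) | ∀ σ ∈ Sig, σ ∈ U ∧ ∀ s ∈ S, ¬ (openGraph ζ).Reachable σ s}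
  · rw [ind_of_mem hη, ind_of_mem (hiff.2 hη)]
  · rw [ind_of_not_mem hη, ind_of_not_mem (fun h' => hη (hiff.1 h'))]

omit [Fintype V] in
/-- `1{v ↮ N}` is an antitone function of `C_v`: no `n ∈ N` equals `v` or lies on an edge of `C_v`. [folklore] -/
theorem ind_avoid_eq (v : V) (N : Set V) (η : Set (Sym2 V)) :
    ind {C : Set (Sym2 V) | ∀ n ∈ N, ¬ (n = v ∨ ∃ e ∈ C, n ∈ e)} (openEdgeCluster η v) =
      ind {ζ : Set (Sym2 V) | ∀ n ∈ N, ¬ (openGraph ζ).Reachable v n} η := by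
  have hiff : openEdgeCluster η v ∈ {C : Set (Sym2 V) | ∀ n ∈ N, ¬ (n = v ∨ ∃ e ∈ C, n ∈ e)} ↔
      η ∈ {ζ : Set (Sym2 V) | ∀ n ∈ N, ¬ (openGraph ζ).Reachable v n} := by
    simp only [mem_setOf_eq]
    refine forall₂_congr fun n _ => not_congr ?_
    exact (reachable_iff_exists_mem_openEdgeCluster η v n).symm
  by_cases hη : η ∈ {ζ : Set (Sym2 V) | ∀ n ∈ N, ¬ (openGraph ζ).Reachable v n}
  · rw [ind_of_mem hη, ind_of_mem (hiff.2 hη)]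
  · rw [ind_of_not_mem hη, ind_of_not_mem (fun h' => hη (hiff.1 h'))]

omit [Fintype V] in
/-- An indicator of a lower family is antitone. [folklore] -/
theorem ind_antitone_of_lower {𝒬 : Set (Set (Sym2 V))} (h𝒬 : ∀ ⦃C C' : Set (Sym2 V)⦄, C ⊆ C' → C' ∈ 𝒬 → C ∈ 𝒬) :
    Antitone (ind 𝒬) := by
  intro C C' hCC'
  by_cases hC' : C' ∈ 𝒬
  · rw [ind_of_mem hC', ind_of_mem (h𝒬 hCC' hC')]
  · rw [ind_of_not_mem hC']; exact ind_nonneg _ _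

/-! ### The two-set input for the hub weight -/

/-- **The two-set input `hGP` of the hub META-A2, DISCHARGED** (vdBHK Thm 2.1 at `q = 1` with the sets `{v}`, `S`): in the world `G[U]`,
`μ(Σ∩C_v≠∅, v↮S∪N, Σ⊆U, Σ↮S) · μ(v↮S) ≤ μ(Σ∩C_v≠∅, v↮S, Σ⊆U, Σ↮S) · μ(v↮S∪N)`.
[cite: VandenbergHaggstromKahn2005, Thm. 2.1 (p. 9) at q = 1; Remark 1 after Thm. 1.2 (p. 5)] -/
theorem hubGP (w : Sym2 V → ℝ) (hw0 : ∀ e, 0 ≤ w e) (hw1 : ∀ e, w e ≤ 1) (S : Set V) (Sig : Finset V) (v : V)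
    (U : Finset V) (N : Set V) :
    (∑ ω, weight w ω * (hubInd Sig v (rC U v ω) * ind (rD U v (S ∪ N)) ω * ind (avoidAll U Sig S) ω)) *
        Mav w U S v ∅ ≤ EavMix w U S Sig v ∅ * Mav w U S v N := by
  set E : Set (Sym2 V) := edgesIn U with hE
  set pU : Sym2 V → unitInterval := fun e => if e ∈ E then ⟨w e, ⟨hw0 e, hw1 e⟩⟩ else 0 with hpU
  have hpE : ∀ e ∈ E, (pU e : ℝ) = w e := fun e he => by simp only [hpU, if_pos he]
  have hpE' : ∀ e ∉ E, pU e = 0 := fun e he => by simp only [hpU, if_neg he]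
  set ν := prodBernoulli pU with hν
  -- the four quantities as sums with the zeroed weights, then as (set) integrals against `ν`
  set D : Set (BondConfig V) := {ζ | ∀ s ∈ S, ¬ (openGraph ζ).Reachable v s} with hD
  set Nn : Set (BondConfig V) := {ζ | ∀ n ∈ N, ¬ (openGraph ζ).Reachable v n} with hNn
  set Q : Set (BondConfig V) := {ζ | ∀ σ ∈ Sig, σ ∈ U ∧ ∀ s ∈ S, ¬ (openGraph ζ).Reachable σ s} with hQ
  set Hb : BondConfig V → ℝ := fun ζ => hubInd Sig v (openEdgeCluster ζ v) with hHb
  have hDN : ∀ ζ : Set (Sym2 V), ind {ζ : Set (Sym2 V) | ∀ x ∈ S ∪ N, ¬ (openGraph ζ).Reachable v x} ζ = ind Nn ζ * ind D ζ := by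
    intro ζ
    rw [← BHK2006.ind_inter]; congr 1; ext ζ'
    simp only [hNn, hD, mem_setOf_eq, mem_inter_iff, mem_union]
    exact ⟨fun h => ⟨fun n hn => h n (Or.inr hn), fun s hs => h s (Or.inl hs)⟩, fun h x hx => hx.elim (h.2 x) (h.1 x)⟩
  have hS0 : ∀ ζ : Set (Sym2 V), ind {ζ : Set (Sym2 V) | ∀ x ∈ S ∪ ∅, ¬ (openGraph ζ).Reachable v x} ζ = ind D ζ :=
    fun ζ => by rw [union_empty]
  have hQ0 : {ζ : Set (Sym2 V) | ∀ σ ∈ Sig, σ ∈ U ∧ ∀ s ∈ S ∪ ∅, ¬ (openGraph ζ).Reachable σ s} = Q := by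
    rw [union_empty]
  have hL : (∑ ω, weight w ω * (hubInd Sig v (rC U v ω) * ind (rD U v (S ∪ N)) ω * ind (avoidAll U Sig S) ω)) =
      ∫ ζ in D, Hb ζ * ind Q ζ * ind Nn ζ ∂ν := by
    have h := sum_weight_inter_eq_sum w hw0 hw1 E pU hpE hpE' (fun ζ => Hb ζ *
      ind {ζ : Set (Sym2 V) | ∀ x ∈ S ∪ N, ¬ (openGraph ζ).Reachable v x} ζ * ind Q ζ)
    rw [← sum_weight_mul_ind]
    refine (Eq.trans (Finset.sum_congr rfl fun ω _ => rfl) h).trans (Finset.sum_congr rfl fun ζ _ => ?_)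
    rw [hDN]; ring
  have hM0 : Mav w U S v ∅ = ν.real D := by
    have h := sum_weight_inter_eq_sum w hw0 hw1 E pU hpE hpE' (fun ζ =>
      ind {ζ : Set (Sym2 V) | ∀ x ∈ S ∪ ∅, ¬ (openGraph ζ).Reachable v x} ζ)
    rw [← sum_weight_ind, Mav]
    refine (Eq.trans (Finset.sum_congr rfl fun ω _ => rfl) h).trans (Finset.sum_congr rfl fun ζ _ => ?_)
    rw [hS0]
  have hE0 : EavMix w U S Sig v ∅ = ∫ ζ in D, Hb ζ * ind Q ζ ∂ν := by
    have h := sum_weight_inter_eq_sum w hw0 hw1 E pU hpE hpE' (fun ζ => Hb ζ *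
      ind {ζ : Set (Sym2 V) | ∀ x ∈ S ∪ ∅, ¬ (openGraph ζ).Reachable v x} ζ *
        ind {ζ : Set (Sym2 V) | ∀ σ ∈ Sig, σ ∈ U ∧ ∀ s ∈ S ∪ ∅, ¬ (openGraph ζ).Reachable σ s} ζ)
    rw [← sum_weight_mul_ind, EavMix]
    refine (Eq.trans (Finset.sum_congr rfl fun ω _ => rfl) h).trans (Finset.sum_congr rfl fun ζ _ => ?_)
    rw [hS0, hQ0]; ring
  have hMN : Mav w U S v N = ∫ ζ in D, ind Nn ζ ∂ν := by
    have h := sum_weight_inter_eq_sum w hw0 hw1 E pU hpE hpE' (fun ζ =>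
      ind {ζ : Set (Sym2 V) | ∀ x ∈ S ∪ N, ¬ (openGraph ζ).Reachable v x} ζ)
    rw [← sum_weight_mul_ind, Mav]
    refine (Eq.trans (Finset.sum_congr rfl fun ω _ => rfl) h).trans (Finset.sum_congr rfl fun ζ _ => ?_)
    rw [hDN]
  -- vdBHK Thm 2.1 (q = 1) with `F = 1{Σ∩C_v≠∅}·1{Σ⊆U, Σ↮S}` (↑ in `C_v`, ↓ in `C_S`) and `G = -1{v↮N}` (↑ in `C_v`)
  set 𝒬 : Set (Set (Sym2 V)) := {C | ∀ σ ∈ Sig, σ ∈ U ∧ (σ ∉ S ∧ ∀ e ∈ C, σ ∉ e)} with h𝒬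
  set 𝒩 : Set (Set (Sym2 V)) := {C | ∀ n ∈ N, ¬ (n = v ∨ ∃ e ∈ C, n ∈ e)} with h𝒩
  have h𝒬anti : Antitone (ind 𝒬) := ind_antitone_of_lower fun C C' hCC' hC' σ hσ =>
    ⟨(hC' σ hσ).1, (hC' σ hσ).2.1, fun e he => (hC' σ hσ).2.2 e (hCC' he)⟩
  have h𝒩anti : Antitone (ind 𝒩) := ind_antitone_of_lower fun C C' hCC' hC' n hn h =>
    hC' n hn (h.imp id fun ⟨e, he, hne⟩ => ⟨e, hCC' he, hne⟩)
  have key := BHK2006_twoSetConditionalAssociation pU {v} S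
    (fun Cv CT => hubInd Sig v Cv * ind 𝒬 CT) (fun Cv _ => - ind 𝒩 Cv)
    (fun CT C C' hCC' => mul_le_mul_of_nonneg_right (hubInd_mono Sig v hCC') (ind_nonneg _ _))
    (fun C CT CT' h => mul_le_mul_of_nonneg_left (h𝒬anti h) (hubInd_nonneg _ _ _))
    (fun _ C C' hCC' => neg_le_neg (h𝒩anti hCC')) (fun _ _ _ _ => le_rfl)
  have hDs : {ω : BondConfig V | ∀ s ∈ ({v} : Set V), ∀ t ∈ S, ¬ (openGraph ω).Reachable s t} = D := by
    ext ω; simp only [mem_setOf_eq, mem_singleton_iff, forall_eq, hD]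
  simp only [hDs, biUnion_singleton, mul_neg, integral_neg] at key
  have e1 : ∫ ζ in D, hubInd Sig v (openEdgeCluster ζ v) * ind 𝒬 (⋃ t ∈ S, openEdgeCluster ζ t) ∂ν =
      ∫ ζ in D, Hb ζ * ind Q ζ ∂ν :=
    setIntegral_congr_fun MeasurableSet.of_discrete fun ζ _ => by rw [h𝒬, ind_avoid_hub_eq Sig U S ζ]
  have e2 : ∫ ζ in D, ind 𝒩 (openEdgeCluster ζ v) ∂ν = ∫ ζ in D, ind Nn ζ ∂ν :=
    setIntegral_congr_fun MeasurableSet.of_discrete fun ζ _ => by rw [h𝒩, ind_avoid_eq v N ζ]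
  have e3 : ∫ ζ in D, hubInd Sig v (openEdgeCluster ζ v) * ind 𝒬 (⋃ t ∈ S, openEdgeCluster ζ t) *
        ind 𝒩 (openEdgeCluster ζ v) ∂ν = ∫ ζ in D, Hb ζ * ind Q ζ * ind Nn ζ ∂ν :=
    setIntegral_congr_fun MeasurableSet.of_discrete fun ζ _ => by rw [h𝒬, h𝒩, ind_avoid_hub_eq Sig U S ζ, ind_avoid_eq v N ζ]
  rw [e1, e2, e3] at key; rw [hL, hM0, hE0, hMN]; linarith

/-! ### Dictionary: the hub functional at `U = univ` and in the worlds `V ∖ C_Y(ω)` -/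

omit [Fintype V] in
/-- `1{Σ ∩ C_v ≠ ∅}` read on the edge cluster is the indicator of `{∃ σ ∈ Σ, v ↔ σ}`. [folklore] -/
theorem hubInd_openEdgeCluster (SigF : Finset V) (Sig : Set V) (hSF : ∀ σ, σ ∈ SigF ↔ σ ∈ Sig) (v : V) (ζ : Set (Sym2 V)) :
    hubInd SigF v (openEdgeCluster ζ v) = ind {ζ : Set (Sym2 V) | ∃ σ ∈ Sig, (openGraph ζ).Reachable v σ} ζ := by
  have hiff : openEdgeCluster ζ v ∈ {C : Set (Sym2 V) | ∃ σ ∈ SigF, σ = v ∨ ∃ e ∈ C, σ ∈ e} ↔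
      ζ ∈ {ζ : Set (Sym2 V) | ∃ σ ∈ Sig, (openGraph ζ).Reachable v σ} := by
    simp only [mem_setOf_eq]
    constructor
    · rintro ⟨σ, hσ, h⟩
      exact ⟨σ, (hSF σ).1 hσ, (reachable_iff_exists_mem_openEdgeCluster ζ v σ).2 h⟩
    · rintro ⟨σ, hσ, h⟩
      exact ⟨σ, (hSF σ).2 hσ, (reachable_iff_exists_mem_openEdgeCluster ζ v σ).1 h⟩
  unfold hubInd
  by_cases hζ : ζ ∈ {ζ : Set (Sym2 V) | ∃ σ ∈ Sig, (openGraph ζ).Reachable v σ}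
  · rw [ind_of_mem hζ, ind_of_mem (hiff.2 hζ)]
  · rw [ind_of_not_mem hζ, ind_of_not_mem (fun h' => hζ (hiff.1 h'))]

omit [Fintype V] in
/-- The three indicators of `E^mix` at `U = univ` multiply to the indicator of `{v ↮ X} ∩ hubEv Σ v X`. [folklore] -/
theorem hub_ind_prod_eq (SigF : Finset V) (Sig : Set V) (hSF : ∀ σ, σ ∈ SigF ↔ σ ∈ Sig) (v : V) (X : Set V)
    (ζ : Set (Sym2 V)) :
    ind {ζ : Set (Sym2 V) | ∃ σ ∈ Sig, (openGraph ζ).Reachable v σ} ζ *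
        ind {ζ : Set (Sym2 V) | ∀ a ∈ X, ¬ (openGraph ζ).Reachable v a} ζ *
          ind {ζ : Set (Sym2 V) | ∀ σ ∈ SigF, ∀ a ∈ X, ¬ (openGraph ζ).Reachable σ a} ζ =
      ind ({ζ : BondConfig V | ∀ a ∈ X, ¬ (openGraph ζ).Reachable v a} ∩ MixCSH.hubEv Sig v X) ζ := by
  rw [← BHK2006.ind_inter, ← BHK2006.ind_inter]; congr 1; ext ζ'
  simp only [mem_inter_iff, mem_setOf_eq, MixCSH.mem_hubEv]
  constructor
  · rintro ⟨⟨h1, h2⟩, h3⟩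
    exact ⟨h2, h1, fun σ hσ a ha h => h3 σ ((hSF σ).2 hσ) a ha h.symm⟩
  · rintro ⟨h2, h1, h3⟩
    exact ⟨⟨h1, h2⟩, fun σ hσ a ha h => h3 σ ((hSF σ).1 hσ) a ha h.symm⟩

/-- **`E^mix_S(Y)` in `G = G[univ]`**: `E^mix = μ({v ↮ S ∪ Y} ∩ hubEv Σ v (S ∪ Y))`. [cite: VandenbergHaggstromKahn2005, §1 p. 3] -/
theorem EavMix_univ_eq (p : Sym2 V → unitInterval) (v : V) (S : Finset V) (SigF : Finset V) (Sig : Set V)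
    (hSF : ∀ σ, σ ∈ SigF ↔ σ ∈ Sig) (Y : Set V) :
    EavMix (fun e => (p e : ℝ)) Finset.univ (↑S : Set V) SigF v Y =
      (prodBernoulli p).real ({ω : BondConfig V | ∀ a ∈ (↑S ∪ Y : Set V), ¬ (openGraph ω).Reachable v a} ∩
        MixCSH.hubEv Sig v (↑S ∪ Y)) := by
  rw [EavMix, ← sum_weight_ind]
  refine Finset.sum_congr rfl fun ω _ => ?_; congr 1
  have hav : ind (avoidAll Finset.univ SigF (↑S ∪ Y)) ω =
      ind {ζ : Set (Sym2 V) | ∀ σ ∈ SigF, ∀ a ∈ (↑S ∪ Y : Set V), ¬ (openGraph ζ).Reachable σ a} ω := by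
    congr 1; ext ζ
    simp only [mem_avoidAll, Finset.mem_univ, true_and, rD_univ, mem_setOf_eq]
  rw [rC_univ, rD_univ, hubInd_openEdgeCluster SigF Sig hSF, hav, hub_ind_prod_eq SigF Sig hSF]

/-- A vertex lies in the world `V ∖ C_Y(ω)` iff it is not joined to `Y`. [folklore] -/
theorem mem_rest_univ_iff (Y : Set V) (ω : Set (Sym2 V)) (u : V) :
    u ∈ rest Finset.univ Y ω ↔ ∀ y ∈ Y, ¬ (openGraph ω).Reachable y u := by
  rw [mem_rest, mem_sC_univ]
  simp only [Finset.mem_univ, true_and, not_exists, not_and]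

/-- **`M_S(∅)` in the world `G ∖ C_Y(ω)`** = `μ_{p^ω}(v ↮ S)`. [cite: VandenbergHaggstromKahn2005, §2.1 Lemmas 2.3–2.4 (p. 10)] -/
theorem Mav_rest_univ (p : Sym2 V → unitInterval) (v : V) (S : Finset V) (Y : Set V) (ω : Set (Sym2 V)) :
    Mav (fun e => (p e : ℝ)) (rest Finset.univ Y ω) (↑S : Set V) v ∅ =
      (prodBernoulli fun e => if (∃ z ∈ e, ∃ y ∈ Y, (openGraph ω).Reachable y z) then (0 : unitInterval) else p e).real
        {η : BondConfig V | ∀ t ∈ S, ¬ (openGraph η).Reachable v t} := by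
  have h := CSH.sum_weight_rest_univ_set p Y ω (fun ζ =>
    ind {ζ : Set (Sym2 V) | ∀ z ∈ (↑S : Set V) ∪ (∅ : Set V), ¬ (openGraph ζ).Reachable v z} ζ)
  rw [Mav]
  refine (Eq.trans (Finset.sum_congr rfl fun η _ => rfl) h).trans ?_
  rw [ind_eq_indicator_one, integral_indicator_one MeasurableSet.of_discrete]
  congr 1; ext ζ; simp only [union_empty, mem_setOf_eq, Finset.mem_coe]

/-- **`E^mix_S(∅)` in the world `G ∖ C_Y(ω)`** = `1{Σ ↮_ω Y} · μ_{p^ω}({v ↮ S} ∩ hubEv Σ v S)` — the world condition `Σ ⊆ V ∖ C_Y(ω)`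
is the hub-row factor `1{Σ ↮_ω Y}`. [cite: VandenbergHaggstromKahn2005, §2.1 Lemmas 2.3–2.4 (p. 10)] -/
theorem EavMix_rest_univ (p : Sym2 V → unitInterval) (v : V) (S : Finset V) (SigF : Finset V) (Sig : Set V)
    (hSF : ∀ σ, σ ∈ SigF ↔ σ ∈ Sig) (Y : Set V) (ω : Set (Sym2 V)) :
    EavMix (fun e => (p e : ℝ)) (rest Finset.univ Y ω) (↑S : Set V) SigF v ∅ =
      (if (∀ σ ∈ Sig, ∀ y ∈ Y, ¬ (openGraph ω).Reachable y σ) then (1 : ℝ) else 0) *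
        (prodBernoulli fun e => if (∃ z ∈ e, ∃ y ∈ Y, (openGraph ω).Reachable y z) then (0 : unitInterval) else p e).real
          ({η : BondConfig V | ∀ t ∈ S, ¬ (openGraph η).Reachable v t} ∩ MixCSH.hubEv Sig v ↑S) := by
  set U : Finset V := rest Finset.univ Y ω with hU
  set pw : Sym2 V → unitInterval := fun e => if (∃ z ∈ e, ∃ y ∈ Y, (openGraph ω).Reachable y z) then (0 : unitInterval) else p e
    with hpw
  have h := CSH.sum_weight_rest_univ_set p Y ω (fun ζ => hubInd SigF v (openEdgeCluster ζ v) *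
    ind {ζ : Set (Sym2 V) | ∀ z ∈ (↑S : Set V) ∪ (∅ : Set V), ¬ (openGraph ζ).Reachable v z} ζ *
      ind {ζ : Set (Sym2 V) | ∀ σ ∈ SigF, σ ∈ U ∧ ∀ z ∈ (↑S : Set V) ∪ (∅ : Set V), ¬ (openGraph ζ).Reachable σ z} ζ)
  rw [EavMix]
  refine (Eq.trans (Finset.sum_congr rfl fun η _ => rfl) h).trans ?_
  by_cases hχ : ∀ σ ∈ Sig, ∀ y ∈ Y, ¬ (openGraph ω).Reachable y σ
  · rw [if_pos hχ, one_mul]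
    have hσU : ∀ σ ∈ SigF, σ ∈ U := fun σ hσ => (mem_rest_univ_iff Y ω σ).2 (hχ σ ((hSF σ).1 hσ))
    have h3 : ∀ ζ : Set (Sym2 V),
        ind {ζ : Set (Sym2 V) | ∀ σ ∈ SigF, σ ∈ U ∧ ∀ z ∈ (↑S : Set V) ∪ (∅ : Set V), ¬ (openGraph ζ).Reachable σ z} ζ =
          ind {ζ : Set (Sym2 V) | ∀ σ ∈ SigF, ∀ a ∈ (↑S : Set V), ¬ (openGraph ζ).Reachable σ a} ζ := by
      intro ζ; congr 1; ext ζ'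
      simp only [union_empty, mem_setOf_eq]
      exact ⟨fun h σ hσ => (h σ hσ).2, fun h σ hσ => ⟨hσU σ hσ, h σ hσ⟩⟩
    have h2 : ∀ ζ : Set (Sym2 V), ind {ζ : Set (Sym2 V) | ∀ z ∈ (↑S : Set V) ∪ (∅ : Set V), ¬ (openGraph ζ).Reachable v z} ζ =
        ind {ζ : Set (Sym2 V) | ∀ a ∈ (↑S : Set V), ¬ (openGraph ζ).Reachable v a} ζ := fun ζ => by rw [union_empty]
    have hset : {η : BondConfig V | ∀ t ∈ S, ¬ (openGraph η).Reachable v t} =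
        {ζ : BondConfig V | ∀ a ∈ (↑S : Set V), ¬ (openGraph ζ).Reachable v a} := by
      ext ζ; simp only [mem_setOf_eq, Finset.mem_coe]
    simp only [h3, h2, hubInd_openEdgeCluster SigF Sig hSF, hub_ind_prod_eq SigF Sig hSF]
    rw [ind_eq_indicator_one, integral_indicator_one MeasurableSet.of_discrete, hset]
  · rw [if_neg hχ, zero_mul]
    push Not at hχ
    obtain ⟨σ, hσ, y, hy, hyσ⟩ := hχ
    have hσU : σ ∉ U := fun h => (mem_rest_univ_iff Y ω σ).1 h y hy hyσ
    have h3 : ∀ ζ : Set (Sym2 V),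
        ind {ζ : Set (Sym2 V) | ∀ σ ∈ SigF, σ ∈ U ∧ ∀ z ∈ (↑S : Set V) ∪ (∅ : Set V), ¬ (openGraph ζ).Reachable σ z} ζ = 0 :=
      fun ζ => ind_of_not_mem fun h => hσU (h σ ((hSF σ).2 hσ)).1
    simp only [h3, mul_zero, integral_zero]

end CovTau

namespace MixCSH

open CovTau CSH

variable {V : Type*} [Fintype V]

/-- **(Htw-mix) in world form, UNCONDITIONAL** (memo §3.4; from `CovTau.p1Mix_univ` with the two-set input `CovTau.hubGP`): for `x ∈ S`,
`v ∉ S`, `g` monotone `≥ 0`, every `Y` and hub set `Σ`,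
`μ(v↮S∪Y, hubEv Σ v (S∪Y))·∫_{x↮Y} Cov_{w^ω}(g(C_x),1{v↔S}) ≤ μ(v↮S∪Y)·∫_{x↮Y} 1{Σ↮_ωY}·p^Σ_ω·Cov_{w^ω}(g(C_x),1{v↔S})`,
`p^Σ_ω = μ_{w^ω}(v↮S, hubEv Σ v S)/μ_{w^ω}(v↮S)` — exactly the hypothesis `hHtw` of `MixCSH.hpart_nonneg_of_htw_hub`.
[cite: VandenbergHaggstromKahn2005, Thm. 2.1 (p. 9) at q = 1, Thm. 1.1 (pp. 3–5), Thm. 1.4 (p. 7)] [cite: KozmaNitzan2024, Question 9 (§5.5 p. 36)] -/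
theorem htwMix_world (w : Sym2 V → unitInterval) (x : V) (Y : Set V) (S : Finset V) (hxS : x ∈ S) (Sig : Set V) (v : V)
    (hvS : v ∉ S) (g : Set (Sym2 V) → ℝ) (hg : Monotone g) (hg0 : ∀ C, 0 ≤ g C) :
    (prodBernoulli w).real ({ω : BondConfig V | ∀ a ∈ (↑S ∪ Y : Set V), ¬ (openGraph ω).Reachable v a} ∩ hubEv Sig v (↑S ∪ Y)) *
        (∫ ω in {ω : BondConfig V | ∀ y ∈ Y, ¬ (openGraph ω).Reachable x y},
          ((∫ η in (⋃ t ∈ S, openConn v t), g (openEdgeCluster η x)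
              ∂(prodBernoulli fun e => if (∃ z ∈ e, ∃ y ∈ Y, (openGraph ω).Reachable y z) then (0 : unitInterval) else w e)) -
            (prodBernoulli fun e => if (∃ z ∈ e, ∃ y ∈ Y, (openGraph ω).Reachable y z) then (0 : unitInterval) else w e).real
                (⋃ t ∈ S, openConn v t) *
              (∫ η, g (openEdgeCluster η x)
                ∂(prodBernoulli fun e => if (∃ z ∈ e, ∃ y ∈ Y, (openGraph ω).Reachable y z) then (0 : unitInterval) else w e)))
          ∂(prodBernoulli w)) ≤
      (prodBernoulli w).real {ω : BondConfig V | ∀ a ∈ (↑S ∪ Y : Set V), ¬ (openGraph ω).Reachable v a} *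
        (∫ ω in {ω : BondConfig V | ∀ y ∈ Y, ¬ (openGraph ω).Reachable x y},
          ((if (∀ σ ∈ Sig, ∀ y ∈ Y, ¬ (openGraph ω).Reachable y σ) then (1 : ℝ) else 0) *
            ((prodBernoulli fun e => if (∃ z ∈ e, ∃ y ∈ Y, (openGraph ω).Reachable y z) then (0 : unitInterval) else w e).real
                ({η : BondConfig V | ∀ t ∈ S, ¬ (openGraph η).Reachable v t} ∩ hubEv Sig v ↑S) /
              (prodBernoulli fun e => if (∃ z ∈ e, ∃ y ∈ Y, (openGraph ω).Reachable y z) then (0 : unitInterval) else w e).real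
                {η : BondConfig V | ∀ t ∈ S, ¬ (openGraph η).Reachable v t})) *
          ((∫ η in (⋃ t ∈ S, openConn v t), g (openEdgeCluster η x)
              ∂(prodBernoulli fun e => if (∃ z ∈ e, ∃ y ∈ Y, (openGraph ω).Reachable y z) then (0 : unitInterval) else w e)) -
            (prodBernoulli fun e => if (∃ z ∈ e, ∃ y ∈ Y, (openGraph ω).Reachable y z) then (0 : unitInterval) else w e).real
                (⋃ t ∈ S, openConn v t) *
              (∫ η, g (openEdgeCluster η x)
                ∂(prodBernoulli fun e => if (∃ z ∈ e, ∃ y ∈ Y, (openGraph ω).Reachable y z) then (0 : unitInterval) else w e)))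
          ∂(prodBernoulli w)) := by
  set w' : Sym2 V → ℝ := fun e => (w e : ℝ) with hw'
  have hw0 : ∀ e, 0 ≤ w' e := fun e => (w e).2.1
  have hw1 : ∀ e, w' e ≤ 1 := fun e => (w e).2.2
  have hm : ∑ ω, weight w' ω = 1 := sum_weight_coe_eq_one w
  set SigF : Finset V := Sig.toFinset with hSigF
  have hSF : ∀ σ, σ ∈ SigF ↔ σ ∈ Sig := fun σ => by rw [hSigF, Set.mem_toFinset]
  have key := p1Mix_univ w' hw0 hw1 hm (S := (↑S : Set V)) (Finset.mem_coe.2 hxS) (fun h => hvS (Finset.mem_coe.1 h))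
    SigF hg hg0 (fun U' _ N _ => hubGP w' hw0 hw1 (↑S : Set V) SigF v U' N) Y
  have hE := EavMix_univ_eq w v S SigF Sig hSF Y
  have hM := Mav_univ_eq w v S Y
  have hY : Yw w' Finset.univ x (fun U' => BfS w' U' x (↑S : Set V) v g) Y =
      ∫ ω in {ω : BondConfig V | ∀ y ∈ Y, ¬ (openGraph ω).Reachable x y},
          ((∫ η in (⋃ t ∈ S, openConn v t), g (openEdgeCluster η x)
              ∂(prodBernoulli fun e => if (∃ z ∈ e, ∃ y ∈ Y, (openGraph ω).Reachable y z) then (0 : unitInterval) else w e)) -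
            (prodBernoulli fun e => if (∃ z ∈ e, ∃ y ∈ Y, (openGraph ω).Reachable y z) then (0 : unitInterval) else w e).real
                (⋃ t ∈ S, openConn v t) *
              (∫ η, g (openEdgeCluster η x)
                ∂(prodBernoulli fun e => if (∃ z ∈ e, ∃ y ∈ Y, (openGraph ω).Reachable y z) then (0 : unitInterval) else w e)))
          ∂(prodBernoulli w) := by
    rw [Yw]
    simp only [hw', BfS_rest_univ, rD_univ]
    exact sum_weight_mul_ind w _ _
  have hX : Yw w' Finset.univ x (fun U' => EavMix w' U' (↑S : Set V) SigF v ∅ / Mav w' U' (↑S : Set V) v ∅ *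
      BfS w' U' x (↑S : Set V) v g) Y =
      ∫ ω in {ω : BondConfig V | ∀ y ∈ Y, ¬ (openGraph ω).Reachable x y},
          ((if (∀ σ ∈ Sig, ∀ y ∈ Y, ¬ (openGraph ω).Reachable y σ) then (1 : ℝ) else 0) *
            ((prodBernoulli fun e => if (∃ z ∈ e, ∃ y ∈ Y, (openGraph ω).Reachable y z) then (0 : unitInterval) else w e).real
                ({η : BondConfig V | ∀ t ∈ S, ¬ (openGraph η).Reachable v t} ∩ hubEv Sig v ↑S) /
              (prodBernoulli fun e => if (∃ z ∈ e, ∃ y ∈ Y, (openGraph ω).Reachable y z) then (0 : unitInterval) else w e).real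
                {η : BondConfig V | ∀ t ∈ S, ¬ (openGraph η).Reachable v t})) *
          ((∫ η in (⋃ t ∈ S, openConn v t), g (openEdgeCluster η x)
              ∂(prodBernoulli fun e => if (∃ z ∈ e, ∃ y ∈ Y, (openGraph ω).Reachable y z) then (0 : unitInterval) else w e)) -
            (prodBernoulli fun e => if (∃ z ∈ e, ∃ y ∈ Y, (openGraph ω).Reachable y z) then (0 : unitInterval) else w e).real
                (⋃ t ∈ S, openConn v t) *
              (∫ η, g (openEdgeCluster η x)
                ∂(prodBernoulli fun e => if (∃ z ∈ e, ∃ y ∈ Y, (openGraph ω).Reachable y z) then (0 : unitInterval) else w e)))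
          ∂(prodBernoulli w) := by
    rw [Yw]
    simp only [hw', BfS_rest_univ, EavMix_rest_univ w v S SigF Sig hSF, Mav_rest_univ, rD_univ, mul_div_assoc]
    exact sum_weight_mul_ind w _ _
  rw [hE, hY, hM, hX] at key
  exact key

/-- **LEMMA H with a hub observer, UNCONDITIONAL** (memo §3.4; brick B4 of the mixed hierarchy CLOSED): for weights `< 1`, a marker set
`S ∋ x`, a hub set `Σ`, an observer `v ∉ S ∪ Y` and a monotone edge-cluster functional `g ≥ 0`, the H-part of the mixed world-wise unfolding
is nonnegative — `MixCSH.hpart_nonneg_of_htw_hub` (p211136) fed with `htwMix_world`.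
[cite: VandenbergHaggstromKahn2005, Thm. 2.1 (p. 9) at q = 1, Thm. 1.4 (p. 7)] [cite: KozmaNitzan2024, Question 9 (§5.5 p. 36)] -/
theorem hpart_nonneg_hub (w : Sym2 V → unitInterval) (hw : ∀ e, w e < 1) (x : V) (Y : Set V) (S : Finset V)
    (hxS : x ∈ S) (Sig : Set V) (v : V) (hvS : v ∉ S) (hvY : v ∉ Y) (g : Set (Sym2 V) → ℝ) (hg : Monotone g) (hg0 : ∀ C, 0 ≤ g C) :
    0 ≤ ∫ ω in {ω : BondConfig V | ∀ y ∈ Y, ¬ (openGraph ω).Reachable x y},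
      ((if (∀ σ ∈ Sig, ∀ y ∈ Y, ¬ (openGraph ω).Reachable y σ) then (1 : ℝ) else 0) *
          ((∫ η in {η : BondConfig V | ∃ σ ∈ Sig, ∃ t ∈ S, (openGraph η).Reachable t σ}, g (openEdgeCluster η x)
              ∂(prodBernoulli fun e => if (∃ z ∈ e, ∃ y ∈ Y, (openGraph ω).Reachable y z) then (0 : unitInterval) else w e)) -
            (prodBernoulli fun e => if (∃ z ∈ e, ∃ y ∈ Y, (openGraph ω).Reachable y z) then (0 : unitInterval) else w e).real
                {η : BondConfig V | ∃ σ ∈ Sig, ∃ t ∈ S, (openGraph η).Reachable t σ} *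
              (∫ η, g (openEdgeCluster η x)
                ∂(prodBernoulli fun e => if (∃ z ∈ e, ∃ y ∈ Y, (openGraph ω).Reachable y z) then (0 : unitInterval) else w e))) -
        mixObsConst w Sig v (↑S ∪ Y) *
          ((∫ η in (⋃ t ∈ S, openConn v t), g (openEdgeCluster η x)
              ∂(prodBernoulli fun e => if (∃ z ∈ e, ∃ y ∈ Y, (openGraph ω).Reachable y z) then (0 : unitInterval) else w e)) -
            (prodBernoulli fun e => if (∃ z ∈ e, ∃ y ∈ Y, (openGraph ω).Reachable y z) then (0 : unitInterval) else w e).real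
                (⋃ t ∈ S, openConn v t) *
              (∫ η, g (openEdgeCluster η x)
                ∂(prodBernoulli fun e => if (∃ z ∈ e, ∃ y ∈ Y, (openGraph ω).Reachable y z) then (0 : unitInterval) else w e))))
      ∂(prodBernoulli w) :=
  hpart_nonneg_of_htw_hub w hw x Y S hxS Sig v hvS hvY g hg hg0 (htwMix_world w x Y S hxS Sig v hvS g hg hg0)

end MixCSH

end Summit.CriticalPhenomena.PercolationContinuityZ3.Theorems
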